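import Mathlib

set_option linter.dupNamespace false

/-!
# Joint freeness law, part A (lens 4, g29): the greedy dichotomy for a pencil of matrices (K1 of the `(c0)` road, joint form)

Kernel step K1 of the critic's `(c0)` road (REFEREE-66v65 §«What would make (c0) KERNEL»: «(P5) greedy/structure lemma over
`ZMod p` matrices, Finset induction on maximal free sets»), stated at once in the JOINT form of Lemma N3 (NODE-g28 §5e, `(c0)₂`)
and for a pencil of ANY number `t` of matrices, so that `(c0)`, `(c0)₂` and `(c0)_s` (S-PRIME §12) share it.

Data: over a field `F`, a pencil `S : Fin t → (Fin n → Fin n → F)` (row `j` of member `r` is `S r j`), extra rows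
`Λ : Fin k → (Fin n → F)` (the linear-form labels), a column set `B` on which weights are measured and a threshold `w`.
* `comb S Λ a a'` — the row vector `Σ_{r,i} a r i • S r i + Σ_q a' q • Λ q`;
* `Free S Λ B w I` — `I` is JOINTLY FREE: every combination with pencil coefficients supported in `I` and not all zero has
  weight `≥ w` on `B` (the single-matrix `FREE(I)` of `(c0)` (P5) is `t = 1`; the `FREE₂(I)` of Lemma N3 is `t = 2`);
* `StructDir S Λ B w I j θ` / `Struct S Λ B w I j` — the pencil rows at `j` are STRUCTURED over `I` (in direction `θ` / in
  some direction `θ ≠ 0`): the row `Σ_r θ r • S r j` is, up to a vector of weight `< w` on `B`, a combination of the pencil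
  rows indexed by `I` and of the `Λ q`.
Theorems: `free_empty`, `free_mono` (subsets of free sets are free), `struct_of_not_free_insert` (the witness bookkeeping (t1) of
66v74: a witness against `insert j I` that vanished at `j` would witness against `I`), the GREEDY DICHOTOMY `free_dichotomy`
(inside any domain `D`: a free set of size `m₁`, or a free set of size `< m₁` over which EVERY other point of `D` is structured —
take a free subset of `D` of maximum cardinality), and the direction pigeonhole `exists_popular_direction` (finite `F`: some
non-zero direction `θ` serves at least `N` of the structured points once `(|F|^t − 1)·N ≤` their number), and the choice
packaging `structured_family` (one direction class ↦ coefficient tables `c j`, `c' j` and light vectors `s j` with the EXACT row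
identity `Σ_r θ r S r j = Σ_{r,i} c j r i S r i + Σ_q c' j q Λ q + s j`, `wtOn B (s j) < w` — the input format of part B).
Pure linear algebra / counting; no game object is mentioned.  Supports stmt-QuantumAdvantage-28487 (record; the residual
`X = AbsorptionDial.NoPerfectPolyOdd` is NOT claimed).
-/

namespace Summit.QuantumAdvantage.QuantumAdvantage.Theorems.JointFreeness

open Finset

variable {F : Type*} [Field F] {n t k : ℕ}

/-- weight of a row vector on the column set `B`: the number of columns `l ∈ B` with `v l ≠ 0` -/
noncomputable def wtOn (B : Finset (Fin n)) (v : Fin n → F) : ℕ := by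
  classical exact (B.filter fun l => v l ≠ 0).card

/-- the combination `Σ_{r,i} a r i • S r i + Σ_q a' q • Λ q` of pencil rows and label rows, as a row vector -/
def comb (S : Fin t → Fin n → Fin n → F) (Λ : Fin k → Fin n → F) (a : Fin t → Fin n → F) (a' : Fin k → F) :
    Fin n → F :=
  fun l => (∑ r, ∑ i, a r i * S r i l) + ∑ q, a' q * Λ q l

/-- the pencil coefficients `a` are supported in `I` -/
def SuppIn (I : Finset (Fin n)) (a : Fin t → Fin n → F) : Prop := ∀ r i, i ∉ I → a r i = 0

/-- **joint freeness** of `I` at weight `w` on `B`: every combination with pencil coefficients supported in `I`, not all zero,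
has weight at least `w` on `B` -/
def Free (S : Fin t → Fin n → Fin n → F) (Λ : Fin k → Fin n → F) (B : Finset (Fin n)) (w : ℕ) (I : Finset (Fin n)) :
    Prop :=
  ∀ (a : Fin t → Fin n → F) (a' : Fin k → F), SuppIn I a → (∃ r i, a r i ≠ 0) → w ≤ wtOn B (comb S Λ a a')

/-- the pencil rows at `j` are **structured over `I` in direction `θ`**: the row `Σ_r θ r • S r j` plus a combination
supported in `I` (and of the `Λ q`) has weight `< w` on `B` -/
def StructDir (S : Fin t → Fin n → Fin n → F) (Λ : Fin k → Fin n → F) (B : Finset (Fin n)) (w : ℕ)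
    (I : Finset (Fin n)) (j : Fin n) (θ : Fin t → F) : Prop :=
  ∃ c : Fin t → Fin n → F, SuppIn I c ∧ ∃ c' : Fin k → F, wtOn B (fun l => (∑ r, θ r * S r j l) + comb S Λ c c' l) < w

/-- the pencil rows at `j` are **structured over `I`** in SOME non-zero direction -/
def Struct (S : Fin t → Fin n → Fin n → F) (Λ : Fin k → Fin n → F) (B : Finset (Fin n)) (w : ℕ) (I : Finset (Fin n))
    (j : Fin n) : Prop :=
  ∃ θ : Fin t → F, θ ≠ 0 ∧ StructDir S Λ B w I j θ

section Basic

variable (S : Fin t → Fin n → Fin n → F) (Λ : Fin k → Fin n → F) (B : Finset (Fin n)) (w : ℕ)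

/-- the empty set is free (there is no non-zero coefficient supported in `∅`) -/
theorem free_empty : Free S Λ B w ∅ := by
  intro a a' hsupp hne
  obtain ⟨r, i, hri⟩ := hne
  exact absurd (hsupp r i (by simp)) hri

/-- subsets of free sets are free -/
theorem free_mono {I J : Finset (Fin n)} (hJI : J ⊆ I) (hI : Free S Λ B w I) : Free S Λ B w J := by
  intro a a' hsupp hne
  exact hI a a' (fun r i hi => hsupp r i fun hiJ => hi (hJI hiJ)) hne

/-- splitting a combination supported in `insert j I` into its `j`-part and a combination supported in `I` -/
theorem comb_split (a : Fin t → Fin n → F) (a' : Fin k → F) (j : Fin n) :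
    comb S Λ a a' = fun l => (∑ r, a r j * S r j l) +
      comb S Λ (fun r i => if i = j then 0 else a r i) a' l := by
  classical
  funext l
  unfold comb
  have key : ∀ r, ∑ i, a r i * S r i l = a r j * S r j l + ∑ i, (if i = j then 0 else a r i) * S r i l := by
    intro r
    have h1 : ∑ i, a r i * S r i l = ∑ i, ((if i = j then a r j * S r j l else 0) +
        (if i = j then 0 else a r i) * S r i l) := by
      refine Finset.sum_congr rfl fun i _ => ?_
      by_cases hij : i = j
      · subst hij; simp
      · simp [hij]
    rw [h1, Finset.sum_add_distrib, Finset.sum_ite_eq' univ j, if_pos (mem_univ j)]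
  rw [Finset.sum_congr rfl fun r _ => key r, Finset.sum_add_distrib]
  ring

/-- **witness bookkeeping** ((t1) of 66v74): if `I` is free, `j ∉ I`, and `insert j I` is not free, then the pencil rows at
`j` are structured over `I` — a witness against `insert j I` has a non-zero coefficient at `j`, else it would witness against `I`. -/
theorem struct_of_not_free_insert {I : Finset (Fin n)} {j : Fin n} (hI : Free S Λ B w I)
    (h : ¬ Free S Λ B w (insert j I)) : Struct S Λ B w I j := by
  classical
  unfold Free at h
  push Not at h
  obtain ⟨a, a', hsupp, hne, hlt⟩ := h
  refine ⟨fun r => a r j, ?_, fun r i => if i = j then 0 else a r i, ?_, a', ?_⟩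
  · -- the direction is non-zero, else the witness is supported in `I` and contradicts the freeness of `I`
    intro hθ
    have hsuppI : SuppIn I a := by
      intro r i hi
      by_cases hij : i = j
      · subst hij; exact congrFun hθ r
      · exact hsupp r i (by simp [hij, hi])
    exact absurd (hI a a' hsuppI hne) (not_le.mpr hlt)
  · intro r i hi
    by_cases hij : i = j
    · simp [hij]
    · simp only [hij, if_false]
      exact hsupp r i (by simp [hij, hi])
  · rw [comb_split S Λ a a' j] at hlt
    exact hlt

/-- **THE GREEDY DICHOTOMY** (K1, joint form).  Inside any domain `D` of coordinates and for every target size `m₁`: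
EITHER some jointly free `I ⊆ D` has exactly `m₁` elements, OR some jointly free `I ⊆ D` with fewer than `m₁` elements has
every other point of `D` structured over it.  (Take a free subset of `D` of maximum cardinality.) -/
theorem free_dichotomy (D : Finset (Fin n)) (m₁ : ℕ) :
    (∃ I, I ⊆ D ∧ Free S Λ B w I ∧ I.card = m₁) ∨
    (∃ I, I ⊆ D ∧ Free S Λ B w I ∧ I.card < m₁ ∧ ∀ j ∈ D, j ∉ I → Struct S Λ B w I j) := by
  classical
  set fam := D.powerset.filter (fun I => Free S Λ B w I) with hfam
  have hne : fam.Nonempty := ⟨∅, by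
    rw [hfam, mem_filter]
    exact ⟨empty_mem_powerset D, free_empty S Λ B w⟩⟩
  obtain ⟨I, hIfam, hImax⟩ := exists_max_image fam Finset.card hne
  rw [hfam, mem_filter, mem_powerset] at hIfam
  obtain ⟨hID, hIfree⟩ := hIfam
  by_cases hm : m₁ ≤ I.card
  · obtain ⟨J, hJI, hJcard⟩ := Finset.exists_subset_card_eq hm
    exact Or.inl ⟨J, hJI.trans hID, free_mono S Λ B w hJI hIfree, hJcard⟩
  · refine Or.inr ⟨I, hID, hIfree, not_le.mp hm, fun j hjD hjI => ?_⟩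
    refine struct_of_not_free_insert S Λ B w hIfree fun hfree => ?_
    have hmem : insert j I ∈ fam := by
      rw [hfam, mem_filter, mem_powerset]
      exact ⟨insert_subset hjD hID, hfree⟩
    have := hImax (insert j I) hmem
    rw [card_insert_of_notMem hjI] at this
    omega

end Basic

section Pigeonhole

variable [Fintype F] [DecidableEq F]

/-- the number of non-zero directions in `Fin t → F` is `|F|^t − 1` -/
theorem card_nonzero_directions : ((univ : Finset (Fin t → F)).filter (fun θ => θ ≠ 0)).card = Fintype.card F ^ t - 1 := by
  rw [filter_ne' univ (0 : Fin t → F), card_erase_of_mem (mem_univ _), card_univ, Fintype.card_fun, Fintype.card_fin]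

/-- **direction pigeonhole**: if every point of `J` carries a non-zero direction and `(|F|^t − 1)·N ≤ |J|`, some non-zero
direction is carried by at least `N` points of `J` -/
theorem exists_popular_direction (J : Finset (Fin n)) (θ : Fin n → (Fin t → F)) (hθ : ∀ j ∈ J, θ j ≠ 0) (N : ℕ)
    (hN : (Fintype.card F ^ t - 1) * N ≤ J.card) (hJ : J.Nonempty) :
    ∃ θ₀ : Fin t → F, θ₀ ≠ 0 ∧ N ≤ (J.filter fun j => θ j = θ₀).card := by
  set T := (univ : Finset (Fin t → F)).filter (fun θ => θ ≠ 0) with hT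
  have hmaps : ∀ j ∈ J, θ j ∈ T := fun j hj => by
    rw [hT, mem_filter]; exact ⟨mem_univ _, hθ j hj⟩
  have hTne : T.Nonempty := by
    obtain ⟨j, hj⟩ := hJ
    exact ⟨θ j, hmaps j hj⟩
  have hcard : T.card * N ≤ J.card := by rw [hT, card_nonzero_directions]; exact hN
  obtain ⟨θ₀, hθ₀T, hθ₀⟩ := exists_le_card_fiber_of_mul_le_card_of_maps_to hmaps hTne hcard
  rw [hT, mem_filter] at hθ₀T
  exact ⟨θ₀, hθ₀T.2, hθ₀⟩

end Pigeonhole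

section Family

variable (S : Fin t → Fin n → Fin n → F) (Λ : Fin k → Fin n → F) (B : Finset (Fin n)) (w : ℕ)

/-- `comb` is linear in the coefficients: negating all coefficients negates the combination -/
theorem comb_neg (a : Fin t → Fin n → F) (a' : Fin k → F) :
    comb S Λ (fun r i => -a r i) (fun q => -a' q) = fun l => -comb S Λ a a' l := by
  funext l
  unfold comb
  simp only [neg_mul, Finset.sum_neg_distrib]
  ring

/-- **choice packaging of a direction class** (the input format of part B).  If every `j ∈ J` is structured over `I` in the
SAME direction `θ`, there are coefficient tables `c j` (supported in `I`), `c' j` and light vectors `s j` (`wtOn B (s j) < w`)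
with the exact row identity `Σ_r θ r S r j l = Σ_{r,i} c j r i S r i l + Σ_q c' j q Λ q l + s j l` for all `j ∈ J` and ALL `l`. -/
theorem structured_family (I J : Finset (Fin n)) (θ : Fin t → F) (h : ∀ j ∈ J, StructDir S Λ B w I j θ) :
    ∃ (c : Fin n → Fin t → Fin n → F) (c' : Fin n → Fin k → F) (s : Fin n → Fin n → F),
      (∀ j ∈ J, SuppIn I (c j)) ∧ (∀ j ∈ J, wtOn B (s j) < w) ∧
      ∀ j ∈ J, ∀ l, (∑ r, θ r * S r j l) = (∑ r, ∑ i, c j r i * S r i l) + (∑ q, c' j q * Λ q l) + s j l := by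
  classical
  -- choose the witnesses pointwise (zero outside `J`)
  have hc : ∀ j, ∃ (c : Fin t → Fin n → F) (c' : Fin k → F), j ∈ J →
      SuppIn I c ∧ wtOn B (fun l => (∑ r, θ r * S r j l) + comb S Λ c c' l) < w := by
    intro j
    by_cases hj : j ∈ J
    · obtain ⟨c, hsupp, c', hlt⟩ := h j hj
      exact ⟨c, c', fun _ => ⟨hsupp, hlt⟩⟩
    · exact ⟨0, 0, fun hj' => absurd hj' hj⟩
  choose c₀ c₀' hc₀ using hc
  refine ⟨fun j r i => -c₀ j r i, fun j q => -c₀' j q, fun j l => (∑ r, θ r * S r j l) + comb S Λ (c₀ j) (c₀' j) l,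
    fun j hj r i hi => ?_, fun j hj => (hc₀ j hj).2, fun j _ l => ?_⟩
  · simp only [(hc₀ j hj).1 r i hi, neg_zero]
  · have hneg := congrFun (comb_neg S Λ (c₀ j) (c₀' j)) l
    unfold comb at hneg ⊢
    rw [hneg]
    ring

end Family

end Summit.QuantumAdvantage.QuantumAdvantage.Theorems.JointFreeness
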